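import Summits.NavierStokesRegularity.NavierStokesRegularity.Theorems.SoloSalvageDavlatov2020
import Literature.Analysis.FluidPDE.WeakSolutionMomentumTorus
import HarnessLib

/-!
# Solo salvage for claim C76 `Davlatov2020`, part 3: the mean identity (6.2) in its TRUE (a.e.) form

Continuation of `Theorems/SoloSalvageDavlatov2020.lean` (seat `ns-claims-salvage-p2`). Step 2 of
`Literature/Claims/NS/Davlatov2020.lean` types (6.1)–(6.2), p.14 («the solutions u ∈ L²(0,T;V) ∩ L^∞(0,T;H)
of (4.4)–(4.7) satisfy (6.1)», integrated) as `Step2_Identity62`: for EVERY weak solution of the typed class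
and EVERY `t ∈ [0,T]`. In that class (bare space–time weak formulation, no weak continuity, `u 0` not tied to
`u₀`) the identity at every `t` is representative-dependent; its print-faithful TRUE content is the
momentum balance ALMOST EVERYWHERE in time, which this file proves in the kernel from the tree lemma
`Torus.IsWeakNSSolutionForcedOn.integral_inner_const_eq_ae` (`Literature/Analysis/FluidPDE/
WeakSolutionMomentumTorus.lean`: constant test fields + du Bois-Reymond; Temam 1984 Ch. III §1.1):

* `identity62_ae` — for `T > 0`, `f ∈ ForceClass T` and every weak solution `u` (`IsWeakSolution T f u₀ u`):
  `meanSum (u t) = meanSum u₀ + ∫₀ᵗ meanSum (f τ) dτ` for a.e. `t ∈ (0,T)`.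

Original source: the time-sliced weak formulation (Temam 1984 (1.25) / Galdi 2000 Lemma 2.1), not the claim.

WHAT THIS IS NOT: not a claim about NS regularity or blow-up; not a claim about any author beyond the
typed locator.
-/

noncomputable section

open MeasureTheory Set Filter Function
open scoped ENNReal NNReal Topology RealInnerProductSpace

-- The mandated landing namespace repeats the summit name by design (D-0017).
set_option linter.dupNamespace false

namespace Summit.NavierStokesRegularity.NavierStokesRegularity.Theorems

namespace Davlatov2020

open Literature.Claims.NS.Davlatov2020 Literature.Analysis Literature.Analysis.FluidPDE
  Literature.Analysis.FunctionSpaces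

/-- The `i`-th spatial mean is the pairing with the constant field `eᵢ`. [folklore] -/
private theorem integral_apply_eq_integral_inner (v : UnitAddTorus (Fin 3) → EuclideanSpace ℝ (Fin 3))
    (i : Fin 3) :
    ∫ x, v x i ∂(volume : Measure (UnitAddTorus (Fin 3))) =
      ∫ x, ⟪v x, EuclideanSpace.single i (1 : ℝ)⟫ ∂(volume : Measure (UnitAddTorus (Fin 3))) := by
  refine integral_congr_ae (ae_of_all _ fun x => ?_)
  simp [EuclideanSpace.inner_single_right]

/-- The mean of a `C([0,T];L²)` force along `eᵢ` is continuous, hence integrable on bounded intervals.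
[folklore] -/
private theorem continuousOn_integral_apply {T : ℝ}
    {f : ℝ → UnitAddTorus (Fin 3) → EuclideanSpace ℝ (Fin 3)} (hf : ForceClass T f) (i : Fin 3) :
    ContinuousOn (fun s => ∫ x, f s x i ∂(volume : Measure (UnitAddTorus (Fin 3)))) (Icc 0 T) := by
  set e : EuclideanSpace ℝ (Fin 3) := EuclideanSpace.single i 1 with he
  have heq : (fun s => ∫ x, f s x i ∂(volume : Measure (UnitAddTorus (Fin 3)))) =
      fun s => ∫ x, ⟪f s x, e⟫ ∂(volume : Measure (UnitAddTorus (Fin 3))) := by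
    funext s; exact integral_apply_eq_integral_inner (f s) i
  rw [heq]
  intro s₀ hs₀
  rw [ContinuousWithinAt, tendsto_iff_norm_sub_tendsto_zero]
  have hlim : Tendsto (fun s => ‖e‖ * (eLpNorm (f s - f s₀) 2 volume).toReal) (𝓝[Icc 0 T] s₀) (𝓝 0) := by
    have h1 : Tendsto (fun s => (eLpNorm (f s - f s₀) 2 volume).toReal) (𝓝[Icc 0 T] s₀) (𝓝 0) := by
      have h0 := (ENNReal.tendsto_toReal ENNReal.zero_ne_top).comp (hf.1.2 s₀ hs₀)
      rw [ENNReal.toReal_zero] at h0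
      exact h0
    simpa using h1.const_mul ‖e‖
  refine squeeze_zero_norm' ?_ hlim
  filter_upwards [self_mem_nhdsWithin] with s hs
  have hfs : MemLp (f s) 2 volume := hf.1.1 s hs
  have hfs₀ : MemLp (f s₀) 2 volume := hf.1.1 s₀ hs₀
  have hdiff : MemLp (f s - f s₀) 2 volume := hfs.sub hfs₀
  have i1 : Integrable (fun x => ⟪f s x, e⟫) volume :=
    Torus.integrable_inner_of_continuous (hfs.integrable one_le_two) continuous_const
  have i2 : Integrable (fun x => ⟪f s₀ x, e⟫) volume :=
    Torus.integrable_inner_of_continuous (hfs₀.integrable one_le_two) continuous_const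
  rw [norm_norm, ← integral_sub i1 i2, Real.norm_eq_abs]
  have hsub : (fun x => ⟪f s x, e⟫ - ⟪f s₀ x, e⟫) = fun x => ⟪(f s - f s₀) x, e⟫ := by
    funext x; simp [inner_sub_left]
  rw [hsub]
  have h1 := Torus.abs_integral_inner_le_of_norm_le (hdiff.integrable one_le_two) (a := fun _ => e)
    (K := ‖e‖) (fun _ => le_rfl)
  refine h1.trans (mul_le_mul_of_nonneg_left ?_ (norm_nonneg _))
  have h2 : ∫ x, ‖(f s - f s₀) x‖ = (eLpNorm (f s - f s₀) 1 volume).toReal := by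
    rw [eLpNorm_one_eq_lintegral_enorm, integral_norm_eq_lintegral_enorm hdiff.1]
  rw [h2]
  exact ENNReal.toReal_mono hdiff.eLpNorm_ne_top
    (eLpNorm_le_eLpNorm_of_exponent_le one_le_two hdiff.1)

/-- **Step 2 in its TRUE form — the mean identity (6.2), p.14, ALMOST EVERYWHERE in time** (Temam 1984
Ch. III §1.1 (1.25) tested with the constant fields `eᵢ ∈ V`, exactly as the paper says «we put the vector
(1,1,1) in place of v»; Galdi 2000 Lemma 2.1): for `T > 0`, a force of `ForceClass T` and EVERY weak solution of
(4.4)–(4.7) in the typed class, `Σᵢ∫uᵢ(t) = Σᵢ∫u₀,ᵢ + ∫₀ᵗ Σᵢ∫fᵢ` for a.e. `t ∈ (0,T)`. (The typed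
`Step2_Identity62` asks it at every `t` for every representative, which the bare weak class cannot give.)
[cite: Davlatov2016NSPeriodic, eq. (6.1)–(6.2) p. 14] -/
theorem identity62_ae (T : ℝ) (_hT : 0 < T)
    (f : ℝ → UnitAddTorus (Fin 3) → EuclideanSpace ℝ (Fin 3))
    (u₀ : UnitAddTorus (Fin 3) → EuclideanSpace ℝ (Fin 3))
    (u : ℝ → UnitAddTorus (Fin 3) → EuclideanSpace ℝ (Fin 3))
    (hf : ForceClass T f) (hu : IsWeakSolution T f u₀ u) :
    ∀ᵐ t ∂(volume.restrict (Ioo 0 T)),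
      meanSum (u t) = meanSum u₀ + ∫ τ in (0 : ℝ)..t, meanSum (f τ) := by
  -- the hypotheses of the tree lemma
  obtain ⟨C, hCtop, hC⟩ := hu.2.1
  have hbound : ∃ C : ℝ≥0∞, C < ⊤ ∧ ∀ᵐ t ∂(volume.restrict (Ioo 0 T)),
      ∫⁻ x, ‖u t x‖ₑ ^ 2 ∂(volume : Measure (UnitAddTorus (Fin 3))) ≤ C := ⟨C, hCtop, hC⟩
  have hL2 : ∀ᵐ s ∂(volume.restrict (Ioo 0 T)), MemLp (u s) 2 (volume : Measure (UnitAddTorus (Fin 3))) := by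
    filter_upwards [hu.2.2.1] with s hs
    exact FluidPDE.memLp_complexify_comp_iff.1 (Torus.MemSobolev.memLp_two_holds hs zero_le_one)
  -- componentwise balances, a.e.
  have hcomp : ∀ i : Fin 3, ∀ᵐ t ∂(volume.restrict (Ioo 0 T)),
      ∫ x, u t x i ∂(volume : Measure (UnitAddTorus (Fin 3))) =
        (∫ x, u₀ x i ∂(volume : Measure (UnitAddTorus (Fin 3)))) +
          ∫ s in Ioc 0 t, ∫ x, f s x i ∂(volume : Measure (UnitAddTorus (Fin 3))) := by
    intro i
    have h := hu.1.integral_inner_const_eq_ae hbound hL2 hf.1 (EuclideanSpace.single i (1 : ℝ))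
    filter_upwards [h] with t ht
    simp only [integral_apply_eq_integral_inner]
    exact ht
  rw [← ae_all_iff] at hcomp
  filter_upwards [hcomp, ae_restrict_mem measurableSet_Ioo] with t ht htI
  -- sum the three components
  have hint : ∀ i : Fin 3, IntervalIntegrable (fun s => ∫ x, f s x i ∂(volume : Measure (UnitAddTorus (Fin 3))))
      volume 0 t := fun i =>
    ((continuousOn_integral_apply hf i).mono (Icc_subset_Icc le_rfl htI.2.le)).intervalIntegrable_of_Icc htI.1.le
  unfold meanSum
  rw [intervalIntegral.integral_finsetSum (fun i _ => hint i), ← Finset.sum_add_distrib]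
  refine Finset.sum_congr rfl fun i _ => ?_
  rw [ht i, intervalIntegral.integral_of_le htI.1.le]

end Davlatov2020

end Summit.NavierStokesRegularity.NavierStokesRegularity.Theorems
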